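import Literature.Probability.Percolation.SlabRSWRectCrossings
import Literature.Probability.Percolation.InequalitiesProofs
import HarnessLib

/-!
# Newman–Tassion–Wu 2017, §3.3 — the half-side square-root trick and the symmetries of `f_p`

Topic: `Literature/Probability/Percolation`. The first step of the proof of Proposition 3.9:
"Invariance under reflection and the square root trick imply
`P_p[X ⟷^S T(S)] ≥ 1 - √(1 - f_p(n,n))`" for `X` the left half of the bottom side of the square
`S`, together with the reflection/transposition symmetries of rectangle crossings in the slab.

* `isLocalEvent_slabConn_boxR`, `measurableSet_slabConn_boxR` — crossing events of a
  rectangle are local, hence measurable.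
* `real_bt_eq_lr` — `P_p[B ⟷ T in [a,b]×[c,d]] = P_p[L ⟷ R in [c,d]×[a,b]]` (transposition).
* `real_halfBottom_top_ge` — PROVED: for `X = [a, m] × {c}` with `a + b ≤ 2m + 1` (at least the
  left half of the bottom side), `1 - √(1 - P_p[B(S) ⟷^S T(S)]) ≤ P_p[X ⟷^S T(S)]`.

## Sources

* C. M. Newman, V. Tassion, W. Wu, *Critical percolation and the minimal spanning tree in slabs*,
  Comm. Pure Appl. Math. 70 (2017), arXiv:1512.09107: §3.3, proof of Proposition 3.9, first
  display [NewmanTassionWu2017].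
-/

noncomputable section

namespace Literature.Probability.Percolation

open MeasureTheory LatticeModels SimpleGraph

namespace NTW17

variable {k : ℕ}

/-- Crossing events of a rectangle of the slab are local. [cite: NewmanTassionWu2017, §2.3 (Notation)] -/
theorem isLocalEvent_slabConn_boxR (a b c d : ℤ) (X Y : Set (ℤ × ℤ)) :
    IsLocalEvent (slabConn k (boxR a b c d) X Y) := by
  refine ⟨(finite_sym2 (slabLift_finite k (boxR_finite a b c d))).toFinset, ?_⟩
  rw [Set.Finite.coe_toFinset]
  exact determinedBy_slabConn k X Y subset_rfl

/-- Crossing events of a rectangle of the slab are measurable. [cite: NewmanTassionWu2017, §2.3 (Notation)] -/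
theorem measurableSet_slabConn_boxR (a b c d : ℤ) (X Y : Set (ℤ × ℤ)) :
    MeasurableSet (slabConn k (boxR a b c d) X Y) :=
  measurableSet_of_isLocalEvent_holds (isLocalEvent_slabConn_boxR a b c d X Y)

/-- **Transposition symmetry**: the bottom-top crossing probability of `[a,b] × [c,d]` equals the
left-right crossing probability of `[c,d] × [a,b]`.
[cite: NewmanTassionWu2017, §3.3 ("by symmetry", f_p(m,n))] -/
theorem real_bt_eq_lr (a b c d : ℤ) (p : unitInterval) :
    (bondPercolation (slabGraph 3 k) p).real (slabConn k (boxR a b c d) {z | z.2 = c} {z | z.2 = d}) =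
      (bondPercolation (slabGraph 3 k) p).real (slabConn k (boxR c d a b) {z | z.1 = c} {z | z.1 = d}) := by
  have hS : planarSwap '' boxR c d a b = boxR a b c d := image_planarSwap_boxR c d a b
  have hX : planarSwap '' {z : ℤ × ℤ | z.1 = c} = {z | z.2 = c} := by
    rw [image_planarSwap_eq]; ext z; simp
  have hY : planarSwap '' {z : ℤ × ℤ | z.1 = d} = {z | z.2 = d} := by
    rw [image_planarSwap_eq]; ext z; simp
  rw [← hS, ← hX, ← hY, real_slabConn_image k planarSwap planarAdj_planarSwap]

/-- **The half-side square-root trick** (first step of the proof of Prop. 3.9): in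
`S = [a,b] × [c,d]`, for `X = [a, m] × {c}` containing at least the left half of the bottom side
(`a + b ≤ 2m + 1`), `1 - √(1 - P_p[B(S) ⟷^S T(S)]) ≤ P_p[X ⟷^S T(S)]`: the bottom side is covered
by `X` and its mirror image, which have the same crossing probability (reflection
`x ↦ a + b - x`), and both events are increasing.
[cite: NewmanTassionWu2017, §3.3 (proof of Proposition 3.9, "invariance under reflection and the square root trick")] -/
theorem real_halfBottom_top_ge {a b c d m : ℤ} (hm : a + b ≤ 2 * m + 1) (p : unitInterval) :
    1 - Real.sqrt (1 - (bondPercolation (slabGraph 3 k) p).real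
        (slabConn k (boxR a b c d) {z | z.2 = c} {z | z.2 = d})) ≤
      (bondPercolation (slabGraph 3 k) p).real
        (slabConn k (boxR a b c d) {z | z.2 = c ∧ a ≤ z.1 ∧ z.1 ≤ m} {z | z.2 = d}) := by
  classical
  set P := bondPercolation (slabGraph 3 k) p with hP
  -- the two events: from the left part `X` and from its mirror image `X'`
  set E₁ := slabConn k (boxR a b c d) {z : ℤ × ℤ | z.2 = c ∧ a ≤ z.1 ∧ z.1 ≤ m} {z | z.2 = d} with hE₁
  set E₂ := slabConn k (boxR a b c d) {z : ℤ × ℤ | z.2 = c ∧ a + b - m ≤ z.1 ∧ z.1 ≤ b} {z | z.2 = d}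
    with hE₂
  let A : Bool → Set (BondConfig (slab 3 k)) := fun i => cond i E₁ E₂
  have hAup : ∀ i, IsUpperSet (A i) := by
    intro i; cases i <;> exact isUpperSet_openCrossing _ _ _
  have hAm : ∀ i, MeasurableSet (A i) := by
    intro i; cases i <;> exact measurableSet_slabConn_boxR _ _ _ _ _ _
  -- equal probabilities by the reflection `x ↦ a + b - x`
  have hgS : planarReflect (a + b) '' boxR a b c d = boxR a b c d := image_planarReflect_boxR a b c d
  have hgX : planarReflect (a + b) '' {z : ℤ × ℤ | z.2 = c ∧ a ≤ z.1 ∧ z.1 ≤ m} =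
      {z : ℤ × ℤ | z.2 = c ∧ a + b - m ≤ z.1 ∧ z.1 ≤ b} := by
    rw [image_planarReflect_eq]
    ext z
    simp only [Set.mem_setOf_eq]
    omega
  have hgT : planarReflect (a + b) '' {z : ℤ × ℤ | z.2 = d} = {z | z.2 = d} := by
    rw [image_planarReflect_eq]
    ext z
    simp only [Set.mem_setOf_eq]
  have heq : P.real E₂ = P.real E₁ := by
    have h := real_slabConn_image k (planarReflect (a + b)) (planarAdj_planarReflect (a + b)) p
      (boxR a b c d) {z : ℤ × ℤ | z.2 = c ∧ a ≤ z.1 ∧ z.1 ≤ m} {z : ℤ × ℤ | z.2 = d}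
    rw [hgS, hgX, hgT] at h
    rw [hE₂, hE₁, hP]
    exact h
  have hAeq : ∀ i, P.real (A i) = P.real E₁ := by
    intro i; cases i
    · exact heq
    · rfl
  -- the union covers the bottom-top crossing
  have hcover : slabConn k (boxR a b c d) {z | z.2 = c} {z | z.2 = d} ⊆ ⋃ i, A i := by
    intro ω hω
    obtain ⟨l, hl⟩ := (mem_slabConn_iff_exists_isOSAP ω _ _ _).1 hω
    have hx := hl.head_mem hl.ne_nil
    have hxS := hl.subset _ (List.head_mem hl.ne_nil)
    rw [mem_slabLift_iff, Set.mem_setOf_eq] at hx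
    rw [mem_slabLift_iff, mem_boxR_iff] at hxS
    by_cases hxm : (planar k (l.head hl.ne_nil)).1 ≤ m
    · refine Set.mem_iUnion.2 ⟨true, ?_⟩
      exact (mem_slabConn_iff_exists_isOSAP ω _ _ _).2 ⟨l, ⟨hl.nodup, hl.chain, hl.subset, hl.ne_nil,
        fun h => by rw [mem_slabLift_iff]; exact ⟨hx, hxS.1, hxm⟩, hl.last_mem⟩⟩
    · refine Set.mem_iUnion.2 ⟨false, ?_⟩
      exact (mem_slabConn_iff_exists_isOSAP ω _ _ _).2 ⟨l, ⟨hl.nodup, hl.chain, hl.subset, hl.ne_nil,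
        fun h => by rw [mem_slabLift_iff]; exact ⟨hx, by omega, hxS.2.1⟩, hl.last_mem⟩⟩
  obtain ⟨i, hi⟩ := sqrt_trick_holds (slabGraph 3 k) p A hAup hAm
  rw [hAeq i] at hi
  refine le_trans ?_ hi
  have hcard : ((Fintype.card Bool : ℝ))⁻¹ = 1 / 2 := by norm_num
  rw [hcard, ← Real.sqrt_eq_rpow]
  have hmono : P.real (slabConn k (boxR a b c d) {z | z.2 = c} {z | z.2 = d}) ≤ P.real (⋃ i, A i) :=
    measureReal_mono hcover
  have h1 : P.real (⋃ i, A i) ≤ 1 := measureReal_le_one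
  gcongr

end NTW17

end Literature.Probability.Percolation
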